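import Summits.BirchSwinnertonDyer.BirchSwinnertonDyer.Theorems.PrintX9MuPartSpecWitnessOfHowardShape
import Literature.NumberTheory.GaloisCohomology.Howard2004.ConclusionCurrencyProofs
import HarnessLib

/-!
# A `SpecWitness` at `q_m` from S1 (control) and the CONCLUSION of Howard's Theorem 1.6.1 on a
# `Howard2004.DVRSetting` over `S_m = Λ/(q_m)` (the composition `…_of` of the shared μ-item's skeleton v9,
# generic in the setting) — proofs file

Cell `pub/bsd-print-x9`, seat `bsd-line-x9-p1` LEAD g3 (2026-08-28). THEOREMS ONLY; no definition, no named fact, no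
`sorry`; ROUTE-INDEPENDENT. Namespace of the shared letters / witness interface
(`Summit.BirchSwinnertonDyer.BirchSwinnertonDyer.Theorems.HeegnerMuPartStabilized`).

WHAT. `nonempty_specWitness_of_dvrConclusion`: let `m ≥ 1`, `S_m = Λ ⧸ (T^m + p)` (a DVR), and let
`Set : Howard2004.DVRSetting p K S_m …` be ANY setting (lit g30's (W9)-B, p642393) with `hy : Set.SatisfiesH` and a
Kolyvagin system `κ : Set.KolyvaginSystem` whose bottom class is non-zero, for which the CONCLUSION
`Set.Conclusion hy κ.one` of the cite-only fact `Howard2004.thm161_dvrKolyvaginBound` holds (binder `h161` of the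
skeleton: `h161 … Set κ hy hLarge hone`). GIVEN the glue identifying the setting's limit Selmer module
`lim_k H¹_F(K, T_k)` with an honest `S_m`-module `H` (additive injection `ι` onto `limitSelmer`, `S_m`-action =
`smulFamily`) and Thm 1.6.1's conclusion OPENED — the generator `x` of the free rank-one limit Selmer module, an honest
`S_m`-module `𝒜` with an `S_m`-LINEAR `e𝒜 : 𝒜 ≃ FracModR S_m × (M × M)` (the instance's transport of the printed additive
`Φ` on `selmerA`, whose linearity is its one-line representative check), `M` finite, and the printed bound
`κ.one = r₁ • x → len M ≤ len(S_m/(r₁))` — and GIVEN the S1 control data (`f : 𝔖 → H` with `f(Λκ_∞) ≤ Λ∙κ₁`,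
`κ₁` the element of `H` over `κ.one`, `#coker f ≤ c`; `h : 𝒳/q_m𝒳 → 𝒜^∨` with `#ker h ≤ c`), THEN
`Nonempty (SpecWitness Λ 𝔖 𝒳 Λκ_∞ q_m c)`. Proof: the generator `x` of the free rank-one `limitSelmer` gives
`e : H ≃ₗ[S_m] S_m` (`LinearEquiv.ofBijective (toSpanSingleton x₀)`), `κ.one = r₁ • x` turns the printed bound
`len M ≤ len(S_m/(r₁))` into `len M ≤ len(H/S_m∙κ₁)` (`length_quotient_span_singleton_eq_of_smul_generator`,
p642968), `Φ/R` is divisible (`FracModR.exists_smul_eq`), and p638335's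
`nonempty_specWitness_of_howardShape` concludes. HONEST FRAMING: nothing here constructs the setting, its hypotheses,
the Kolyvagin system or the control maps (those are STUBS 1–3 of SKELETON-v9-PLAN); «beyond-print theorem»: no.
BSD is not proved by any of this; no summit statement is proved by this seat.

References: [Howard2004HeegnerKolyvagin] Thm. 1.6.1 and proof of Thm. 2.2.10 (𝔮 = T^m + p); [MastellaZerman2026] Thm. 2.40.
-/

set_option linter.dupNamespace false
set_option autoImplicit false

noncomputable section

open scoped Classical Pointwise nonZeroDivisors

open Literature Literature.NumberTheory.EllipticCurves WeierstrassCurve NumberField IsDedekindDomain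
open Literature.NumberTheory.GaloisCohomology.Howard2004 Literature.NumberTheory.GaloisRepresentations

namespace Summit.BirchSwinnertonDyer.BirchSwinnertonDyer.Theorems.HeegnerMuPartStabilized

set_option maxHeartbeats 400000 in
/-- **A `SpecWitness` at `q_m` from S1 data and the conclusion of Howard Thm 1.6.1 on a `DVRSetting` over
`S_m = Λ/(q_m)`** (see the module docstring for the glue hypothesis `ι` and the opened conclusion `x`, `e𝒜`, `hbound`).
[cite: Howard2004HeegnerKolyvagin, Thm. 1.6.1 and proof of Thm. 2.2.10 (𝔮 = T^m + p)] [cite: MastellaZerman2026, Thm. 2.40] -/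
theorem nonempty_specWitness_of_dvrConclusion {p : ℕ} [hp : Fact p.Prime] {m : ℕ} (hm : 1 ≤ m)
    [IsDomain (IwasawaAlgebra p ⧸
      Ideal.span {(PowerSeries.X ^ m + PowerSeries.C (p : ℤ_[p]) : IwasawaAlgebra p)})]
    [IsDiscreteValuationRing (IwasawaAlgebra p ⧸
      Ideal.span {(PowerSeries.X ^ m + PowerSeries.C (p : ℤ_[p]) : IwasawaAlgebra p)})]
    -- the frame modules `𝔖 ⊇ Λκ_∞`, `𝒳`
    {S X : Type} [AddCommGroup S] [Module (IwasawaAlgebra p) S] [AddCommGroup X] [Module (IwasawaAlgebra p) X]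
    (L : Submodule (IwasawaAlgebra p) S)
    -- a DVR setting over `S_m`
    {K : Type} [Field K] [NumberField K]
    {N : ℕ → Type} [∀ k, AddCommGroup (N k)] [∀ k, TopologicalSpace (N k)]
    [∀ k, DiscreteTopology (N k)]
    [∀ k, Module (IwasawaAlgebra p ⧸
      Ideal.span {(PowerSeries.X ^ m + PowerSeries.C (p : ℤ_[p]) : IwasawaAlgebra p)}) (N k)]
    {Rk : ℕ → Type} [∀ k, CommRing (Rk k)] [∀ k, IsLocalRing (Rk k)] [∀ k, TopologicalSpace (Rk k)]
    [∀ k, DiscreteTopology (Rk k)] [∀ k, Algebra ℤ_[p] (Rk k)]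
    [∀ k, Algebra (IwasawaAlgebra p ⧸
      Ideal.span {(PowerSeries.X ^ m + PowerSeries.C (p : ℤ_[p]) : IwasawaAlgebra p)}) (Rk k)]
    [∀ k, Module (Rk k) (N k)]
    [∀ k, IsScalarTower (IwasawaAlgebra p ⧸
      Ideal.span {(PowerSeries.X ^ m + PowerSeries.C (p : ℤ_[p]) : IwasawaAlgebra p)}) (Rk k) (N k)]
    {Nbar : Type} [AddCommGroup Nbar] [TopologicalSpace Nbar] [DiscreteTopology Nbar]
    [∀ k, Module (Rk k) Nbar]
    {Nq : ℕ → Finset (HeightOneSpectrum (𝓞 K)) → Type} [∀ k n, AddCommGroup (Nq k n)]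
    [∀ k n, TopologicalSpace (Nq k n)] [∀ k n, DiscreteTopology (Nq k n)]
    [∀ k n, Module (Rk k) (Nq k n)]
    [∀ k n, Module (IwasawaAlgebra p ⧸
      Ideal.span {(PowerSeries.X ^ m + PowerSeries.C (p : ℤ_[p]) : IwasawaAlgebra p)}) (Nq k n)]
    [∀ k n, IsScalarTower (IwasawaAlgebra p ⧸
      Ideal.span {(PowerSeries.X ^ m + PowerSeries.C (p : ℤ_[p]) : IwasawaAlgebra p)}) (Rk k) (Nq k n)]
    (St : DVRSetting p K (IwasawaAlgebra p ⧸
      Ideal.span {(PowerSeries.X ^ m + PowerSeries.C (p : ℤ_[p]) : IwasawaAlgebra p)}) N Rk Nbar Nq)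
    (κ : St.KolyvaginSystem) (hone : κ.one ≠ 0)
    -- Thm 1.6.1's conclusion, opened: (i) the generator `x` of the free rank-one `lim_k H¹_F(K, T_k)` …
    (x : ∀ k, galoisCohomology (St.T.ρ k) 1)
    (hfree : St.T.IsFreeRankOneOn (St.T.limitSelmer fun k => (St.t k).cond) x)
    -- … (ii) `H¹_F(K, A) ≅ 𝒟 ⊕ M ⊕ M` transported to an honest `S_m`-module `𝒜`, and (iii) the bound
    {𝒜 : Type} [AddCommGroup 𝒜] [Module (IwasawaAlgebra p) 𝒜]
    [Module (IwasawaAlgebra p ⧸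
      Ideal.span {(PowerSeries.X ^ m + PowerSeries.C (p : ℤ_[p]) : IwasawaAlgebra p)}) 𝒜]
    {M : Type} [AddCommGroup M]
    [Module (IwasawaAlgebra p ⧸
      Ideal.span {(PowerSeries.X ^ m + PowerSeries.C (p : ℤ_[p]) : IwasawaAlgebra p)}) M] [Finite M]
    (e𝒜 : 𝒜 ≃ₗ[IwasawaAlgebra p ⧸
      Ideal.span {(PowerSeries.X ^ m + PowerSeries.C (p : ℤ_[p]) : IwasawaAlgebra p)}]
      FracModR (IwasawaAlgebra p ⧸
        Ideal.span {(PowerSeries.X ^ m + PowerSeries.C (p : ℤ_[p]) : IwasawaAlgebra p)}) × (M × M))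
    (hbound : ∀ r₁ : IwasawaAlgebra p ⧸
        Ideal.span {(PowerSeries.X ^ m + PowerSeries.C (p : ℤ_[p]) : IwasawaAlgebra p)},
      κ.one = St.T.smulFamily r₁ x →
        Module.length (IwasawaAlgebra p ⧸
            Ideal.span {(PowerSeries.X ^ m + PowerSeries.C (p : ℤ_[p]) : IwasawaAlgebra p)}) M ≤
          Module.length (IwasawaAlgebra p ⧸
            Ideal.span {(PowerSeries.X ^ m + PowerSeries.C (p : ℤ_[p]) : IwasawaAlgebra p)})
            ((IwasawaAlgebra p ⧸
              Ideal.span {(PowerSeries.X ^ m + PowerSeries.C (p : ℤ_[p]) : IwasawaAlgebra p)}) ⧸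
              Ideal.span {r₁}))
    -- glue (compact side): an honest `S_m`-module `H` identified with `lim_k H¹_F(K, T_k)`
    {H : Type} [AddCommGroup H] [Module (IwasawaAlgebra p) H]
    [Module (IwasawaAlgebra p ⧸
      Ideal.span {(PowerSeries.X ^ m + PowerSeries.C (p : ℤ_[p]) : IwasawaAlgebra p)}) H]
    [IsScalarTower (IwasawaAlgebra p) (IwasawaAlgebra p ⧸
      Ideal.span {(PowerSeries.X ^ m + PowerSeries.C (p : ℤ_[p]) : IwasawaAlgebra p)}) H]
    (ι : H →+ (∀ k, galoisCohomology (St.T.ρ k) 1)) (hι_inj : Function.Injective ι)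
    (hι_range : ∀ y, y ∈ St.T.limitSelmer (fun k => (St.t k).cond) ↔ y ∈ Set.range ι)
    (hι_smul : ∀ (r : IwasawaAlgebra p ⧸
        Ideal.span {(PowerSeries.X ^ m + PowerSeries.C (p : ℤ_[p]) : IwasawaAlgebra p)}) (y : H),
      ι (r • y) = St.T.smulFamily r (ι y))
    -- S1: control
    (f : S →ₗ[IwasawaAlgebra p] H) (κ₁ : H) (hκ₁ : ι κ₁ = κ.one) (hL : L.map f ≤ (IwasawaAlgebra p) ∙ κ₁)
    (c : ℕ) (hcoker : Finite (H ⧸ LinearMap.range f)) (hcoker_le : Nat.card (H ⧸ LinearMap.range f) ≤ c)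
    (h : (X ⧸ ((Ideal.span {(PowerSeries.X ^ m + PowerSeries.C (p : ℤ_[p]) : IwasawaAlgebra p)} :
        Ideal (IwasawaAlgebra p)) • (⊤ : Submodule (IwasawaAlgebra p) X))) →ₗ[IwasawaAlgebra p]
        CharacterModule 𝒜)
    (hker : Finite (LinearMap.ker h)) (hker_le : Nat.card (LinearMap.ker h) ≤ c) :
    Nonempty (SpecWitness (IwasawaAlgebra p) S X L
      (PowerSeries.X ^ m + PowerSeries.C (p : ℤ_[p]) : IwasawaAlgebra p) c) := by
  obtain ⟨hxmem, hann, hgen⟩ := hfree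
  -- `x₀ ∈ H` over the generator `x`
  obtain ⟨x₀, hx₀⟩ : x ∈ Set.range ι := (hι_range x).mp hxmem
  -- every element of `H` is a multiple of `x₀`, uniquely: `H ≅ S_m`
  have hsurj : Function.Surjective (LinearMap.toSpanSingleton (IwasawaAlgebra p ⧸
      Ideal.span {(PowerSeries.X ^ m + PowerSeries.C (p : ℤ_[p]) : IwasawaAlgebra p)}) H x₀) := by
    intro y
    have hy : ι y ∈ St.T.limitSelmer (fun k => (St.t k).cond) := (hι_range _).mpr ⟨y, rfl⟩
    obtain ⟨r, hr⟩ := hgen (ι y) hy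
    refine ⟨r, hι_inj ?_⟩
    rw [LinearMap.toSpanSingleton_apply, hι_smul, hx₀, hr]
  have hinj : Function.Injective (LinearMap.toSpanSingleton (IwasawaAlgebra p ⧸
      Ideal.span {(PowerSeries.X ^ m + PowerSeries.C (p : ℤ_[p]) : IwasawaAlgebra p)}) H x₀) := by
    rw [injective_iff_map_eq_zero]
    intro r hr
    rw [LinearMap.toSpanSingleton_apply] at hr
    apply hann r
    rw [← hx₀, ← hι_smul, hr, map_zero]
  have hex₀ : (LinearEquiv.ofBijective _ ⟨hinj, hsurj⟩).symm x₀ = 1 := by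
    rw [LinearEquiv.symm_apply_eq, LinearEquiv.ofBijective_apply, LinearMap.toSpanSingleton_apply, one_smul]
  -- `κ.one = r₁ • x`, hence `κ₁ = r₁ • x₀ ≠ 0`
  obtain ⟨r₁, hr₁⟩ := hgen κ.one κ.one_mem
  have hκ₁' : κ₁ = r₁ • x₀ := hι_inj (by rw [hκ₁, hr₁, hι_smul, hx₀])
  have hκ : κ₁ ≠ 0 := by
    intro h0
    apply hone
    rw [← hκ₁, h0, map_zero]
  -- the printed bound in the `H ⧸ S_m∙κ₁` currency, divisibility of `𝒟`, and the constructor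
  have hM := hbound r₁ hr₁
  rw [← length_quotient_span_singleton_eq_of_smul_generator (LinearEquiv.ofBijective _ ⟨hinj, hsurj⟩).symm
    hex₀ r₁ hκ₁'] at hM
  exact nonempty_specWitness_of_howardShape hm L f κ₁ hL c hcoker hcoker_le h hker hker_le
    (LinearEquiv.ofBijective _ ⟨hinj, hsurj⟩).symm hκ e𝒜
    (fun r d => FracModR.exists_smul_eq _ r d) hM

set_option maxHeartbeats 400000 in
/-- **The same constructor for a bare bottom class** `one ∈ lim_k H¹_F(K, T_k)`, `one ≠ 0` (no Kolyvagin system in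
the hypotheses): the shape met by skeleton v3's `stub_controlGlue` on the shared μ-crux, where Howard's `Conclusion hy one`
is given for `one := ctrl_m z` (the image of the stabilised class under D1's compact control map).
[cite: Howard2004HeegnerKolyvagin, Thm. 1.6.1 and proof of Thm. 2.2.10 (𝔮 = T^m + p)] [cite: MastellaZerman2026, Thm. 2.40] -/
theorem nonempty_specWitness_of_dvrConclusion_one {p : ℕ} [hp : Fact p.Prime] {m : ℕ} (hm : 1 ≤ m)
    [IsDomain (IwasawaAlgebra p ⧸
      Ideal.span {(PowerSeries.X ^ m + PowerSeries.C (p : ℤ_[p]) : IwasawaAlgebra p)})]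
    [IsDiscreteValuationRing (IwasawaAlgebra p ⧸
      Ideal.span {(PowerSeries.X ^ m + PowerSeries.C (p : ℤ_[p]) : IwasawaAlgebra p)})]
    -- the frame modules `𝔖 ⊇ Λκ_∞`, `𝒳`
    {S X : Type} [AddCommGroup S] [Module (IwasawaAlgebra p) S] [AddCommGroup X] [Module (IwasawaAlgebra p) X]
    (L : Submodule (IwasawaAlgebra p) S)
    -- a DVR setting over `S_m`
    {K : Type} [Field K] [NumberField K]
    {N : ℕ → Type} [∀ k, AddCommGroup (N k)] [∀ k, TopologicalSpace (N k)]
    [∀ k, DiscreteTopology (N k)]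
    [∀ k, Module (IwasawaAlgebra p ⧸
      Ideal.span {(PowerSeries.X ^ m + PowerSeries.C (p : ℤ_[p]) : IwasawaAlgebra p)}) (N k)]
    {Rk : ℕ → Type} [∀ k, CommRing (Rk k)] [∀ k, IsLocalRing (Rk k)] [∀ k, TopologicalSpace (Rk k)]
    [∀ k, DiscreteTopology (Rk k)] [∀ k, Algebra ℤ_[p] (Rk k)]
    [∀ k, Algebra (IwasawaAlgebra p ⧸
      Ideal.span {(PowerSeries.X ^ m + PowerSeries.C (p : ℤ_[p]) : IwasawaAlgebra p)}) (Rk k)]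
    [∀ k, Module (Rk k) (N k)]
    [∀ k, IsScalarTower (IwasawaAlgebra p ⧸
      Ideal.span {(PowerSeries.X ^ m + PowerSeries.C (p : ℤ_[p]) : IwasawaAlgebra p)}) (Rk k) (N k)]
    {Nbar : Type} [AddCommGroup Nbar] [TopologicalSpace Nbar] [DiscreteTopology Nbar]
    [∀ k, Module (Rk k) Nbar]
    {Nq : ℕ → Finset (HeightOneSpectrum (𝓞 K)) → Type} [∀ k n, AddCommGroup (Nq k n)]
    [∀ k n, TopologicalSpace (Nq k n)] [∀ k n, DiscreteTopology (Nq k n)]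
    [∀ k n, Module (Rk k) (Nq k n)]
    [∀ k n, Module (IwasawaAlgebra p ⧸
      Ideal.span {(PowerSeries.X ^ m + PowerSeries.C (p : ℤ_[p]) : IwasawaAlgebra p)}) (Nq k n)]
    [∀ k n, IsScalarTower (IwasawaAlgebra p ⧸
      Ideal.span {(PowerSeries.X ^ m + PowerSeries.C (p : ℤ_[p]) : IwasawaAlgebra p)}) (Rk k) (Nq k n)]
    (St : DVRSetting p K (IwasawaAlgebra p ⧸
      Ideal.span {(PowerSeries.X ^ m + PowerSeries.C (p : ℤ_[p]) : IwasawaAlgebra p)}) N Rk Nbar Nq)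
    (one : ∀ k, galoisCohomology (St.T.ρ k) 1) (hone_mem : one ∈ St.T.limitSelmer fun k => (St.t k).cond)
    (hone : one ≠ 0)
    -- Thm 1.6.1's conclusion, opened: (i) the generator `x` of the free rank-one `lim_k H¹_F(K, T_k)` …
    (x : ∀ k, galoisCohomology (St.T.ρ k) 1)
    (hfree : St.T.IsFreeRankOneOn (St.T.limitSelmer fun k => (St.t k).cond) x)
    -- … (ii) `H¹_F(K, A) ≅ 𝒟 ⊕ M ⊕ M` transported to an honest `S_m`-module `𝒜`, and (iii) the bound
    {𝒜 : Type} [AddCommGroup 𝒜] [Module (IwasawaAlgebra p) 𝒜]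
    [Module (IwasawaAlgebra p ⧸
      Ideal.span {(PowerSeries.X ^ m + PowerSeries.C (p : ℤ_[p]) : IwasawaAlgebra p)}) 𝒜]
    {M : Type} [AddCommGroup M]
    [Module (IwasawaAlgebra p ⧸
      Ideal.span {(PowerSeries.X ^ m + PowerSeries.C (p : ℤ_[p]) : IwasawaAlgebra p)}) M] [Finite M]
    (e𝒜 : 𝒜 ≃ₗ[IwasawaAlgebra p ⧸
      Ideal.span {(PowerSeries.X ^ m + PowerSeries.C (p : ℤ_[p]) : IwasawaAlgebra p)}]
      FracModR (IwasawaAlgebra p ⧸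
        Ideal.span {(PowerSeries.X ^ m + PowerSeries.C (p : ℤ_[p]) : IwasawaAlgebra p)}) × (M × M))
    (hbound : ∀ r₁ : IwasawaAlgebra p ⧸
        Ideal.span {(PowerSeries.X ^ m + PowerSeries.C (p : ℤ_[p]) : IwasawaAlgebra p)},
      one = St.T.smulFamily r₁ x →
        Module.length (IwasawaAlgebra p ⧸
            Ideal.span {(PowerSeries.X ^ m + PowerSeries.C (p : ℤ_[p]) : IwasawaAlgebra p)}) M ≤
          Module.length (IwasawaAlgebra p ⧸
            Ideal.span {(PowerSeries.X ^ m + PowerSeries.C (p : ℤ_[p]) : IwasawaAlgebra p)})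
            ((IwasawaAlgebra p ⧸
              Ideal.span {(PowerSeries.X ^ m + PowerSeries.C (p : ℤ_[p]) : IwasawaAlgebra p)}) ⧸
              Ideal.span {r₁}))
    -- glue (compact side): an honest `S_m`-module `H` identified with `lim_k H¹_F(K, T_k)`
    {H : Type} [AddCommGroup H] [Module (IwasawaAlgebra p) H]
    [Module (IwasawaAlgebra p ⧸
      Ideal.span {(PowerSeries.X ^ m + PowerSeries.C (p : ℤ_[p]) : IwasawaAlgebra p)}) H]
    [IsScalarTower (IwasawaAlgebra p) (IwasawaAlgebra p ⧸
      Ideal.span {(PowerSeries.X ^ m + PowerSeries.C (p : ℤ_[p]) : IwasawaAlgebra p)}) H]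
    (ι : H →+ (∀ k, galoisCohomology (St.T.ρ k) 1)) (hι_inj : Function.Injective ι)
    (hι_range : ∀ y, y ∈ St.T.limitSelmer (fun k => (St.t k).cond) ↔ y ∈ Set.range ι)
    (hι_smul : ∀ (r : IwasawaAlgebra p ⧸
        Ideal.span {(PowerSeries.X ^ m + PowerSeries.C (p : ℤ_[p]) : IwasawaAlgebra p)}) (y : H),
      ι (r • y) = St.T.smulFamily r (ι y))
    -- S1: control
    (f : S →ₗ[IwasawaAlgebra p] H) (κ₁ : H) (hκ₁ : ι κ₁ = one) (hL : L.map f ≤ (IwasawaAlgebra p) ∙ κ₁)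
    (c : ℕ) (hcoker : Finite (H ⧸ LinearMap.range f)) (hcoker_le : Nat.card (H ⧸ LinearMap.range f) ≤ c)
    (h : (X ⧸ ((Ideal.span {(PowerSeries.X ^ m + PowerSeries.C (p : ℤ_[p]) : IwasawaAlgebra p)} :
        Ideal (IwasawaAlgebra p)) • (⊤ : Submodule (IwasawaAlgebra p) X))) →ₗ[IwasawaAlgebra p]
        CharacterModule 𝒜)
    (hker : Finite (LinearMap.ker h)) (hker_le : Nat.card (LinearMap.ker h) ≤ c) :
    Nonempty (SpecWitness (IwasawaAlgebra p) S X L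
      (PowerSeries.X ^ m + PowerSeries.C (p : ℤ_[p]) : IwasawaAlgebra p) c) := by
  obtain ⟨hxmem, hann, hgen⟩ := hfree
  -- `x₀ ∈ H` over the generator `x`
  obtain ⟨x₀, hx₀⟩ : x ∈ Set.range ι := (hι_range x).mp hxmem
  -- every element of `H` is a multiple of `x₀`, uniquely: `H ≅ S_m`
  have hsurj : Function.Surjective (LinearMap.toSpanSingleton (IwasawaAlgebra p ⧸
      Ideal.span {(PowerSeries.X ^ m + PowerSeries.C (p : ℤ_[p]) : IwasawaAlgebra p)}) H x₀) := by
    intro y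
    have hy : ι y ∈ St.T.limitSelmer (fun k => (St.t k).cond) := (hι_range _).mpr ⟨y, rfl⟩
    obtain ⟨r, hr⟩ := hgen (ι y) hy
    refine ⟨r, hι_inj ?_⟩
    rw [LinearMap.toSpanSingleton_apply, hι_smul, hx₀, hr]
  have hinj : Function.Injective (LinearMap.toSpanSingleton (IwasawaAlgebra p ⧸
      Ideal.span {(PowerSeries.X ^ m + PowerSeries.C (p : ℤ_[p]) : IwasawaAlgebra p)}) H x₀) := by
    rw [injective_iff_map_eq_zero]
    intro r hr
    rw [LinearMap.toSpanSingleton_apply] at hr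
    apply hann r
    rw [← hx₀, ← hι_smul, hr, map_zero]
  have hex₀ : (LinearEquiv.ofBijective _ ⟨hinj, hsurj⟩).symm x₀ = 1 := by
    rw [LinearEquiv.symm_apply_eq, LinearEquiv.ofBijective_apply, LinearMap.toSpanSingleton_apply, one_smul]
  -- `one = r₁ • x`, hence `κ₁ = r₁ • x₀ ≠ 0`
  obtain ⟨r₁, hr₁⟩ := hgen one hone_mem
  have hκ₁' : κ₁ = r₁ • x₀ := hι_inj (by rw [hκ₁, hr₁, hι_smul, hx₀])
  have hκ : κ₁ ≠ 0 := by
    intro h0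
    apply hone
    rw [← hκ₁, h0, map_zero]
  -- the printed bound in the `H ⧸ S_m∙κ₁` currency, divisibility of `𝒟`, and the constructor
  have hM := hbound r₁ hr₁
  rw [← length_quotient_span_singleton_eq_of_smul_generator (LinearEquiv.ofBijective _ ⟨hinj, hsurj⟩).symm
    hex₀ r₁ hκ₁'] at hM
  exact nonempty_specWitness_of_howardShape hm L f κ₁ hL c hcoker hcoker_le h hker hker_le
    (LinearEquiv.ofBijective _ ⟨hinj, hsurj⟩).symm hκ e𝒜
    (fun r d => FracModR.exists_smul_eq _ r d) hM

end Summit.BirchSwinnertonDyer.BirchSwinnertonDyer.Theorems.HeegnerMuPartStabilized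

end
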